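/-
Copyright (c) 2026. All rights reserved.
Released under Apache 2.0 license as described in the file LICENSE.
Authors: abc-iut cell, seat abc-iut-w5-d053 (gen 4; row «COR36-FULL-NV» — a non-vacuity witness for the
residual hypothesis of the [AbsTopIII] Cor 3.6 / Cor 3.7 model column).
-/
import Literature.AnabelianGeometry.AbsoluteAnabelian.AbsTopIII.MLFGaloisModelIdRigid
import Mathlib.FieldTheory.Galois.Infinite
import Mathlib.Algebra.Group.MinimalAxioms
import HarnessLib

/-!
# [AbsTopIII] Def 3.1 (i) / Prop 3.2 (iv): the SEMILINEAR AFFINE model object `(Π₀ ↠ G_k ↷ ℚ̄_p)` — definitions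

S. Mochizuki, *Topics in absolute anabelian geometry III* [MochizukiAbsTopIII2015] (kurims manuscript
`paper:url-5493eb38cbb7`), Def 3.1 (i) p. 66 ("Let `Π_k` be a topological group, equipped with a
continuous surjection `ε_k : Π_k ↠ G_k`"), Prop 3.2 (iv) p. 72 ("the natural functor `𝒞^{MLF}_T → 𝒯𝔾`
[...] induces an injection `Isom((Π ↷ M_T), (Π* ↷ M*_T)) ↪ Isom_{𝒯𝔾}(Π, Π*)`; this injection is a
bijection if [...] both [pairs] are of strictly Belyi type"; "`𝒞^{MLF-sB}_T` [...] are id-rigid").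

MODEL / WITNESS DEFINITIONS (seat abc-iut-w5-d053 gen 4, row «COR36-FULL-NV»).  The cell's MODEL of Def 3.1
(abc-iut-L4-t9, `MLFGaloisModelCategories.lean`: `𝒳 = TFModel p`, objects `(Π_k ↠ G_k ↷ ℚ̄_p)` with `Π_k` an
ARBITRARY topological group) carries the Cor 3.6 / Cor 3.7 model column of the layer, whose one residual
hypothesis is the SURJECTIVITY half of Prop 3.2 (iv) on a type `P` of objects, `(P.ι ⋙ TFModel.gal p).Full`
(abc-iut-L4-t9 `biAnabelianLiftOfFull` / `model_of_cor_3_7_of_full`; abc-iut-L4-t5 `AnabelianInput`).  In the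
tree that hypothesis is so far inhabited only VACUOUSLY (`AnabelianInput.ofEmpty`;
`isEmpty_biAnabelianLift_modelSetting(Slim)`; `not_full_gal_slim`).  This file DEFINES, for every MLF
`ℚ_p ⊆ k ⊆ ℚ̄_p`, the witness object

  `affineModel k := (Π₀(k) ↠ G_k ↷ ℚ̄_p)`,  `Π₀(k) := ℚ̄_p ⋊ (ℚ̄_p^× ⋊ G_k)` (`AffPi k`)

— the group of SEMILINEAR AFFINE transformations `x ↦ a·γ(x) + b` (`b ∈ ℚ̄_p`, `a ∈ ℚ̄_p^×`, `γ ∈ G_k`), `ε =`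
the projection to `G_k` (`Π₀` discrete; `ε` a continuous surjection as Def 3.1 (i) asks) — its translations
/ dilations / Galois lifts, the translation subgroup, and the type `IsAffineModel` (`P₀`) of witness objects.
The companions `…AffineWitnessProofs.lean` / `…AffineWitnessFull.lean` (proof-only) show: `Π₀` is centre-free,
`ker ε` is its divisible part, the translations are `⁅ker ε, ker ε⁆`, EVERY abstract group isomorphism
`Π₀(k₁) ≃ Π₀(k₂)` is geometric (affine-group rigidity) — so `Full` holds at the NONEMPTY type `P₀` and
`𝒳_{P₀}` is id-rigid: the Cor 3.6 / 3.7 model column is instantiated NON-VACUOUSLY.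

HONEST FRAMING: `Π₀` is NOT of hyperbolic-orbicurve / strictly-Belyi type (neither profinite nor slim); a
CONSISTENCY / NON-VACUITY witness for the typed hypothesis structure of the model column, not a model of
[AbsTopIII] Cor 1.10.  Refereed pre-IUT material; instances only on this file's own new type `AffPi`; no new
`Prop` fact; nothing here bears on [IUTchIII] Cor. 3.12; instantiated ≠ endorsed.
-/

set_option autoImplicit false

noncomputable section

namespace Literature.AnabelianGeometry.AbsoluteAnabelian.AbsTopIII

open Polynomial

variable {p : ℕ} [hp : Fact p.Prime]

namespace TFModel

variable (k : IntermediateField ℚ_[p] (PadicAlgCl p))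

/-! ## The semilinear affine group `Π₀(k) = ℚ̄_p ⋊ (ℚ̄_p^× ⋊ G_k)` -/

/-- The Galois action of `γ ∈ G_k` on the units `ℚ̄_p^×`.
[cite: MochizukiAbsTopIII2015, Definition 3.1 (i) p.66] -/
abbrev galUnits (γ : PadicAlgCl p ≃ₐ[k] PadicAlgCl p) : (PadicAlgCl p)ˣ →* (PadicAlgCl p)ˣ :=
  Units.map (γ : PadicAlgCl p →* PadicAlgCl p)

/-- The value of `galUnits γ u` is `γ u`. [cite: MochizukiAbsTopIII2015, Definition 3.1 (i) p.66] -/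
@[simp] theorem coe_galUnits (γ : PadicAlgCl p ≃ₐ[k] PadicAlgCl p) (u : (PadicAlgCl p)ˣ) :
    ((galUnits k γ u : (PadicAlgCl p)ˣ) : PadicAlgCl p) = γ (u : PadicAlgCl p) := rfl

/-- **`Π₀(k)`**: an element `⟨b, a, γ⟩` is the semilinear affine transformation `x ↦ a·γ(x) + b` of
`ℚ̄_p` (`b ∈ ℚ̄_p`, `a ∈ ℚ̄_p^×`, `γ ∈ G_k = Gal(ℚ̄_p/k)`); as a group `Π₀(k) = ℚ̄_p ⋊ (ℚ̄_p^× ⋊ G_k)`.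
It plays the "topological group `Π_k` equipped with a continuous surjection `ε_k : Π_k ↠ G_k`" of
Def 3.1 (i) for the witness object `affineModel k`. [cite: MochizukiAbsTopIII2015, Definition 3.1 (i) p.66] -/
@[ext]
structure AffPi : Type where
  /-- the translation part `b` -/
  t : PadicAlgCl p
  /-- the dilation part `a` -/
  u : (PadicAlgCl p)ˣ
  /-- the Galois part `γ` -/
  γ : PadicAlgCl p ≃ₐ[k] PadicAlgCl p

namespace AffPi

variable {k}

/-- Composition of semilinear affine maps `(x ↦ a₁γ₁(x)+b₁) ∘ (x ↦ a₂γ₂(x)+b₂)` (an instance on this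
file's own type). [cite: MochizukiAbsTopIII2015, Definition 3.1 (i) p.66] -/
instance : Mul (AffPi k) :=
  ⟨fun x y => ⟨x.t + x.u * x.γ y.t, x.u * galUnits k x.γ y.u, x.γ * y.γ⟩⟩

/-- The identity affine map. [cite: MochizukiAbsTopIII2015, Definition 3.1 (i) p.66] -/
instance : One (AffPi k) := ⟨⟨0, 1, 1⟩⟩

/-- The inverse affine map. [cite: MochizukiAbsTopIII2015, Definition 3.1 (i) p.66] -/
instance : Inv (AffPi k) :=
  ⟨fun x => ⟨-(((galUnits k x.γ⁻¹ x.u)⁻¹ : (PadicAlgCl p)ˣ) : PadicAlgCl p) * x.γ⁻¹ x.t,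
    (galUnits k x.γ⁻¹ x.u)⁻¹, x.γ⁻¹⟩⟩

/-- Translation part of a product. [cite: MochizukiAbsTopIII2015, Definition 3.1 (i) p.66] -/
@[simp] theorem mul_t (x y : AffPi k) : (x * y).t = x.t + x.u * x.γ y.t := rfl
/-- Dilation part of a product. [cite: MochizukiAbsTopIII2015, Definition 3.1 (i) p.66] -/
@[simp] theorem mul_u (x y : AffPi k) : (x * y).u = x.u * galUnits k x.γ y.u := rfl
/-- Galois part of a product. [cite: MochizukiAbsTopIII2015, Definition 3.1 (i) p.66] -/
@[simp] theorem mul_γ (x y : AffPi k) : (x * y).γ = x.γ * y.γ := rfl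
/-- Translation part of `1`. [cite: MochizukiAbsTopIII2015, Definition 3.1 (i) p.66] -/
@[simp] theorem one_t : (1 : AffPi k).t = 0 := rfl
/-- Dilation part of `1`. [cite: MochizukiAbsTopIII2015, Definition 3.1 (i) p.66] -/
@[simp] theorem one_u : (1 : AffPi k).u = 1 := rfl
/-- Galois part of `1`. [cite: MochizukiAbsTopIII2015, Definition 3.1 (i) p.66] -/
@[simp] theorem one_γ : (1 : AffPi k).γ = 1 := rfl
/-- Galois part of an inverse. [cite: MochizukiAbsTopIII2015, Definition 3.1 (i) p.66] -/
@[simp] theorem inv_γ (x : AffPi k) : (x⁻¹).γ = x.γ⁻¹ := rfl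
/-- Dilation part of an inverse. [cite: MochizukiAbsTopIII2015, Definition 3.1 (i) p.66] -/
theorem inv_u (x : AffPi k) : (x⁻¹).u = (galUnits k x.γ⁻¹ x.u)⁻¹ := rfl
/-- Translation part of an inverse. [cite: MochizukiAbsTopIII2015, Definition 3.1 (i) p.66] -/
theorem inv_t (x : AffPi k) :
    (x⁻¹).t = -(((galUnits k x.γ⁻¹ x.u)⁻¹ : (PadicAlgCl p)ˣ) : PadicAlgCl p) * x.γ⁻¹ x.t := rfl

/-- **`Π₀(k)` is a group** (associativity, left unit, left inverse of semilinear affine maps).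
[cite: MochizukiAbsTopIII2015, Definition 3.1 (i) p.66] -/
instance : Group (AffPi k) :=
  Group.ofLeftAxioms
    (fun x y z => by
      ext
      · simp only [mul_t, mul_u, mul_γ, map_add, map_mul, Units.val_mul, coe_galUnits,
          AlgEquiv.mul_apply]
        ring
      · simp only [mul_u, mul_γ, Units.val_mul, coe_galUnits, map_mul, AlgEquiv.mul_apply, mul_assoc]
      · simp only [mul_γ, mul_assoc])
    (fun x => by
      ext
      · simp only [mul_t, one_t, one_u, one_γ, Units.val_one, AlgEquiv.one_apply, one_mul, zero_add]
      · simp only [mul_u, one_u, one_γ, coe_galUnits, AlgEquiv.one_apply, one_mul]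
      · simp only [mul_γ, one_γ, one_mul])
    (fun x => by
      ext
      · simp only [mul_t, inv_t, inv_u, inv_γ, one_t]
        rw [neg_mul, neg_add_cancel]
      · simp only [mul_u, inv_u, inv_γ, one_u, inv_mul_cancel]
      · simp only [mul_γ, inv_γ, one_γ, inv_mul_cancel])

/-- The projection **`ε : Π₀(k) ↠ G_k`**, `(x ↦ a·γ(x)+b) ↦ γ` (Def 3.1 (i): "a continuous surjection
`ε_k : Π_k ↠ G_k`"). [cite: MochizukiAbsTopIII2015, Definition 3.1 (i) p.66] -/
def ε : AffPi k →* (PadicAlgCl p ≃ₐ[k] PadicAlgCl p) where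
  toFun x := x.γ
  map_one' := rfl
  map_mul' _ _ := rfl

/-- `ε x` is the Galois part of `x`. [cite: MochizukiAbsTopIII2015, Definition 3.1 (i) p.66] -/
@[simp] theorem ε_apply (x : AffPi k) : ε x = x.γ := rfl

/-- `ε` is surjective. [cite: MochizukiAbsTopIII2015, Definition 3.1 (i) p.66] -/
theorem ε_surjective : Function.Surjective (ε (k := k)) := fun γ => ⟨⟨0, 1, γ⟩, rfl⟩

/-- `Π₀(k)` is given the discrete topology (so that every abstract automorphism is a morphism of
double-underlined `𝒯𝔾`). [cite: MochizukiAbsTopIII2015, Definition 3.1 (i) p.66] -/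
instance : TopologicalSpace (AffPi k) := ⊥

/-- The topology of `Π₀(k)` is discrete. [cite: MochizukiAbsTopIII2015, Definition 3.1 (i) p.66] -/
instance : DiscreteTopology (AffPi k) := ⟨rfl⟩

/-- A discrete group is a topological group. [cite: MochizukiAbsTopIII2015, Definition 3.1 (i) p.66] -/
instance : IsTopologicalGroup (AffPi k) where
  continuous_mul := continuous_of_discreteTopology
  continuous_inv := continuous_of_discreteTopology

/-! ### Translations, dilations, Galois lifts -/

/-- The translation `x ↦ x + b`. [cite: MochizukiAbsTopIII2015, Definition 3.1 (i) p.66] -/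
def tr (b : PadicAlgCl p) : AffPi k := ⟨b, 1, 1⟩

/-- The dilation `x ↦ a·x`. [cite: MochizukiAbsTopIII2015, Definition 3.1 (i) p.66] -/
def dil (a : (PadicAlgCl p)ˣ) : AffPi k := ⟨0, a, 1⟩

/-- The Galois lift `x ↦ γ(x)` (a set-theoretic section of `ε`). [cite: MochizukiAbsTopIII2015, Definition 3.1 (i) p.66] -/
def lift (γ : PadicAlgCl p ≃ₐ[k] PadicAlgCl p) : AffPi k := ⟨0, 1, γ⟩

/-- Translation part of `tr b`. [cite: MochizukiAbsTopIII2015, Definition 3.1 (i) p.66] -/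
@[simp] theorem tr_t (b : PadicAlgCl p) : (tr b : AffPi k).t = b := rfl
/-- Dilation part of `tr b`. [cite: MochizukiAbsTopIII2015, Definition 3.1 (i) p.66] -/
@[simp] theorem tr_u (b : PadicAlgCl p) : (tr b : AffPi k).u = 1 := rfl
/-- Galois part of `tr b`. [cite: MochizukiAbsTopIII2015, Definition 3.1 (i) p.66] -/
@[simp] theorem tr_γ (b : PadicAlgCl p) : (tr b : AffPi k).γ = 1 := rfl
/-- Translation part of `dil a`. [cite: MochizukiAbsTopIII2015, Definition 3.1 (i) p.66] -/
@[simp] theorem dil_t (a : (PadicAlgCl p)ˣ) : (dil a : AffPi k).t = 0 := rfl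
/-- Dilation part of `dil a`. [cite: MochizukiAbsTopIII2015, Definition 3.1 (i) p.66] -/
@[simp] theorem dil_u (a : (PadicAlgCl p)ˣ) : (dil a : AffPi k).u = a := rfl
/-- Galois part of `dil a`. [cite: MochizukiAbsTopIII2015, Definition 3.1 (i) p.66] -/
@[simp] theorem dil_γ (a : (PadicAlgCl p)ˣ) : (dil a : AffPi k).γ = 1 := rfl
/-- Translation part of `lift γ`. [cite: MochizukiAbsTopIII2015, Definition 3.1 (i) p.66] -/
@[simp] theorem lift_t (γ : PadicAlgCl p ≃ₐ[k] PadicAlgCl p) : (lift γ).t = 0 := rfl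
/-- Dilation part of `lift γ`. [cite: MochizukiAbsTopIII2015, Definition 3.1 (i) p.66] -/
@[simp] theorem lift_u (γ : PadicAlgCl p ≃ₐ[k] PadicAlgCl p) : (lift γ).u = 1 := rfl
/-- Galois part of `lift γ`. [cite: MochizukiAbsTopIII2015, Definition 3.1 (i) p.66] -/
@[simp] theorem lift_γ (γ : PadicAlgCl p ≃ₐ[k] PadicAlgCl p) : (lift γ).γ = γ := rfl

/-- `tr` turns addition into multiplication: `tr b * tr b' = tr (b + b')`.
[cite: MochizukiAbsTopIII2015, Definition 3.1 (i) p.66] -/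
theorem tr_mul_tr (b b' : PadicAlgCl p) : (tr b * tr b' : AffPi k) = tr (b + b') := by
  ext <;> simp [tr]

/-- `tr 0 = 1`. [cite: MochizukiAbsTopIII2015, Definition 3.1 (i) p.66] -/
@[simp] theorem tr_zero : (tr 0 : AffPi k) = 1 := rfl

/-- The inverse of a translation. [cite: MochizukiAbsTopIII2015, Definition 3.1 (i) p.66] -/
theorem tr_inv (b : PadicAlgCl p) : (tr b : AffPi k)⁻¹ = tr (-b) :=
  inv_eq_of_mul_eq_one_right (by rw [tr_mul_tr, add_neg_cancel, tr_zero])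

/-- `tr` is injective. [cite: MochizukiAbsTopIII2015, Definition 3.1 (i) p.66] -/
theorem tr_injective : Function.Injective (tr (k := k)) := fun b b' h => by
  simpa using congrArg AffPi.t h

/-- Every element factors as translation · dilation · Galois lift.
[cite: MochizukiAbsTopIII2015, Definition 3.1 (i) p.66] -/
theorem eq_tr_mul_dil_mul_lift (x : AffPi k) : x = tr x.t * dil x.u * lift x.γ := by
  ext <;> simp [tr, dil, lift]

/-- Conjugating a translation by a dilation: `dil a · tr b · (dil a)⁻¹ = tr (a·b)`.
[cite: MochizukiAbsTopIII2015, Definition 3.1 (i) p.66] -/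
theorem dil_mul_tr_mul_dil_inv (a : (PadicAlgCl p)ˣ) (b : PadicAlgCl p) :
    (dil a * tr b * (dil a)⁻¹ : AffPi k) = tr ((a : PadicAlgCl p) * b) := by
  have h : (dil a * tr b : AffPi k) = tr ((a : PadicAlgCl p) * b) * dil a := by
    ext <;> simp [tr, dil]
  rw [h, mul_inv_cancel_right]

/-- Conjugating a translation by a Galois lift: `lift γ · tr b · (lift γ)⁻¹ = tr (γ b)`.
[cite: MochizukiAbsTopIII2015, Definition 3.1 (i) p.66] -/
theorem lift_mul_tr_mul_lift_inv (γ : PadicAlgCl p ≃ₐ[k] PadicAlgCl p) (b : PadicAlgCl p) :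
    (lift γ * tr b * (lift γ)⁻¹ : AffPi k) = tr (γ b) := by
  have h : (lift γ * tr b : AffPi k) = tr (γ b) * lift γ := by
    ext <;> simp [tr, lift]
  rw [h, mul_inv_cancel_right]

/-- Conjugating a translation by an arbitrary element: `x · tr b · x⁻¹ = tr (a·γ(b))` for `x = ⟨t, a, γ⟩`.
[cite: MochizukiAbsTopIII2015, Definition 3.1 (i) p.66] -/
theorem mul_tr_mul_inv (x : AffPi k) (b : PadicAlgCl p) :
    x * tr b * x⁻¹ = tr ((x.u : PadicAlgCl p) * x.γ b) := by
  have h : x * tr b = tr ((x.u : PadicAlgCl p) * x.γ b) * x := by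
    ext <;> simp [tr]; ring
  rw [h, mul_inv_cancel_right]

/-- The translation subgroup `T = {x ↦ x + b} ≅ (ℚ̄_p, +)` of `Π₀(k)`.
[cite: MochizukiAbsTopIII2015, Definition 3.1 (i) p.66] -/
def translations : Subgroup (AffPi k) where
  carrier := {x | x.u = 1 ∧ x.γ = 1}
  one_mem' := ⟨rfl, rfl⟩
  mul_mem' := by
    rintro x y ⟨hxu, hxγ⟩ ⟨hyu, hyγ⟩
    refine ⟨?_, by simp [hxγ, hyγ]⟩
    simp only [mul_u, hxu, hyu, hxγ, one_mul]
    exact Units.ext (by simp)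
  inv_mem' := by
    rintro x ⟨hxu, hxγ⟩
    refine ⟨?_, by simp [hxγ]⟩
    rw [inv_u, hxγ, inv_one, hxu]
    exact Units.ext (by simp)

/-- Membership in `T`: trivial dilation and Galois parts. [cite: MochizukiAbsTopIII2015, Definition 3.1 (i) p.66] -/
theorem mem_translations_iff (x : AffPi k) : x ∈ translations ↔ x.u = 1 ∧ x.γ = 1 := Iff.rfl

/-- `tr b ∈ T`. [cite: MochizukiAbsTopIII2015, Definition 3.1 (i) p.66] -/
theorem tr_mem_translations (b : PadicAlgCl p) : (tr b : AffPi k) ∈ translations := ⟨rfl, rfl⟩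

/-- An element of `T` is the translation by its translation part.
[cite: MochizukiAbsTopIII2015, Definition 3.1 (i) p.66] -/
theorem eq_tr_of_mem_translations {x : AffPi k} (hx : x ∈ translations) : x = tr x.t := by
  ext
  · rfl
  · simp [hx.1]
  · simp [hx.2]

end AffPi

/-! ## The witness object `affineModel k = (Π₀(k) ↠ G_k ↷ ℚ̄_p)` of the model category `𝒳` -/

variable [FiniteDimensional ℚ_[p] k]

/-- **The semilinear affine model object** `(Π₀(k) ↠ G_k ↷ ℚ̄_p)` over the MLF `k`: Def 3.1 (i)
model data with `Π_k := Π₀(k)` (discrete) and `ε_k :=` the projection (a continuous surjection).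
[cite: MochizukiAbsTopIII2015, Definition 3.1 (i) p.66] -/
def affineModel : TFModel p where
  k := k
  D := { Pi := AffPi k
         aug := AffPi.ε
         continuous_aug := continuous_of_discreteTopology
         aug_surjective := AffPi.ε_surjective }

/-- The Galois group of `affineModel k` is `Π₀(k)`. [cite: MochizukiAbsTopIII2015, Definition 3.1 (i) p.67] -/
theorem affineModel_Pi : (affineModel k).pair.Pi = AffPi k := rfl

/-- The action of `⟨b, a, γ⟩ ∈ Π₀(k)` on `ℚ̄_p` is through `γ`.
[cite: MochizukiAbsTopIII2015, Definition 3.1 (i) p.67] -/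
theorem affineModel_augQ_apply (g : (affineModel k).pair.Pi) (x : PadicAlgCl p) :
    (affineModel k).augQ g x = (show AffPi k from g).γ x := rfl

/-- The type `P₀` of witness objects: `A ∈ P₀` iff `A = affineModel k` for some MLF `k ⊆ ℚ̄_p`
(a NONEMPTY type of objects of `𝒳`). [cite: MochizukiAbsTopIII2015, Definition 3.1 (iii) p.68] -/
def IsAffineModel : CategoryTheory.ObjectProperty (TFModel p) := fun A =>
  ∃ (k : IntermediateField ℚ_[p] (PadicAlgCl p)) (_ : FiniteDimensional ℚ_[p] k), A = affineModel k

/-- `affineModel k ∈ P₀`. [cite: MochizukiAbsTopIII2015, Definition 3.1 (iii) p.68] -/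
theorem isAffineModel_affineModel : IsAffineModel (affineModel k) := ⟨k, inferInstance, rfl⟩

/-- `P₀` is inhabited (e.g. by the object over `k = ℚ_p`).
[cite: MochizukiAbsTopIII2015, Definition 3.1 (iii) p.68] -/
theorem nonempty_isAffineModel_fullSubcategory :
    Nonempty (IsAffineModel (p := p)).FullSubcategory :=
  ⟨⟨affineModel ⊥, isAffineModel_affineModel ⊥⟩⟩

end TFModel

end Literature.AnabelianGeometry.AbsoluteAnabelian.AbsTopIII

end
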